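import Summits.BirchSwinnertonDyer.BirchSwinnertonDyer.Theorems.SmallImageMuTransferMuTransferX9SelmerDualLocalUnramified
import HarnessLib

/-!
# Route ByReductionTypeAtTwo, crux `OrdKatoHalfAtTwoIso` (stmt-BirchSwinnertonDyer-19573), line
# `steinberg-fibre-at-two`: the Selmer-side stub `hG1` of the odd core WITHOUT `p ≠ 2`, part 2 (places `v ∤ p`)

Seat `cruxlead-stmt-BirchSwinnertonDyer-19573-g0` (LEAD PROVER, MODE LINE), helper W2c (PLAN C).
HONEST FRAMING (cell bsd-2adic): BSD is not proved; the crux `OrdKatoHalfAtTwoIso` is not proved; `stub_port`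
is not proved here. Theorems only (no definition, no named fact, no `sorry`); nothing is asserted about any
curve and nothing is booked (`--supports stmt-BirchSwinnertonDyer-19573 --as helper`).

WHY. The Selmer-side input `hG1 = SelmerDual.stub_selmerDualOdd_holds` of the odd-prime kernel core carries the
prefix `p ≠ 2 → W.HasIrreducibleModPGaloisRep p → ¬ W.HasSurjectiveModNGaloisRep p → κ.IsCyclotomic →
κ.IsTopGenerator γ → (EP) → (PT) →`, and so do its two local lemmas AWAY from `p`, `SelmerDual.localBad` (k6-c2
p456573) and `SelmerDual.localUnramified` (k6-lur-a p462896) — but their PROOFS use none of `p ≠ 2`,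
irreducibility, non-surjectivity, `γ`, (EP), (PT): `localBad` uses only `κ.IsCyclotomic`, `localUnramified`
only the place data. Since a `∀ …, p ≠ 2 → …` statement cannot be instantiated at `p = 2`, the port of `hG1`
to `p = 2` (`stub_port` of line `steinberg-fibre-at-two`, PLAN C of sidea-stub_port-1) needs the two lemmas
RESTATED with the dead binders struck; the proofs below are the odd proofs byte-for-byte after the `intro` line.

* `localBad'` — at every place `v ∤ p` a uniform `ε_v` with `loc_v ((κ⁻¹.shiftH1)^[ε_v] c) = 0` for all levels
  `J` and all `c ∈ H¹(ℚ, 𝒯_J(E, κ⁻¹))`; hypothesis: `κ` cyclotomic. Every prime.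
* `localUnramified'` — at a place `v ∤ p` where `E[p]` is unramified and `E` has good reduction, the
  localisation of the dual test class `Ψ` built from a FINE `y ∈ H¹(ℚ_∞, E[p])` (data `y_n, Y, Ψ, k` with the
  assembly's three relations) is unramified; no hypothesis on `p`, `γ`, the image of `ρ̄`. Every prime.

Part 1 is `…SelmerDualAllPrimeLocal` (the place over `p`); part 3 `…SelmerDualAllPrime` assembles. Credit:
sidea-stub_port-1 STUB-IDEAS-1 @82c64e14eec0e2be Plan C; seats bsd-smallim-k6-c2 / k6-lur-a (odd originals).

References: HOME/koly/MU-TRANSFER-PROOF.md §5 STEP 1 / (F6); J. S. Milne, *ADT* I Thm. 2.8 [MilneADT2006];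
J. H. Silverman, *AEC* X.4 Cor. 4.4, VIII.1.4 [SilvermanAEC2009]; L. Washington (1997) Prop. 13.2
[Washington1997]; J.-P. Serre, *Galois Cohomology* I §2.5 [SerreGaloisCohomology1997]; R. Greenberg, LNM 1716
§1, §3 [GreenbergLNM1716].
-/

set_option linter.dupNamespace false
set_option autoImplicit false

noncomputable section

open scoped Classical NumberField
open Field IsDedekindDomain
open WeierstrassCurve (geomTorsion geomPrimaryTorsion)
open Literature.NumberTheory.GaloisRepresentations
open Literature.NumberTheory.GaloisCohomology
open Literature.NumberTheory.EllipticCurves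

universe u

namespace Summit.BirchSwinnertonDyer.BirchSwinnertonDyer.Rank1Residual.SelmerDual

/-! ## (L-bad), every prime -/

-- adapted from `SelmerDual.localBad` (…X9SelmerDualLocalBad, k6-c2 p456573): dead prefix binders struck
/-- **(L-bad), every prime `p`**: for the cyclotomic `ℤ_p`-extension `κ` and every place `v ∤ p` there is a
uniform `ε_v` with `loc_v ((κ⁻¹.shiftH1)^[ε_v] c) = 0` for all levels `J` and all `c ∈ H¹(ℚ, 𝒯_J(E, κ⁻¹))`
(k6-g4's uniform local exponent at the singleton `{v}`).
[cite: MilneADT2006, Ch. I §2, Thm. 2.8 (p. 31)] [cite: GreenbergLNM1716, §1] -/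
theorem localBad' :
    ∀ (W : WeierstrassCurve ℚ) [W.IsElliptic] (p : ℕ) [Fact p.Prime] (κ : ZpExtension ℚ p),
      κ.IsCyclotomic →
      ∀ v : HeightOneSpectrum (𝓞 ℚ), ((p : ℕ) : 𝓞 ℚ) ∉ v.asIdeal →
        ∃ εv : ℕ, ∀ (J : ℕ) (c : galoisCohomology (W.modPTwist p κ.invTwist J) 1),
          galoisCohomology.localization (W.modPTwist p κ.invTwist J) (Sum.inr v) 1
            ((κ.invTwist.shiftH1 (W.torsionGaloisModule (p : ℤ))
              (fun P : WeierstrassCurve.geomTorsion W (p : ℤ) => AddSubgroup.torsionBy.nsmul P) J)^[εv] c) = 0 := by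
  intro W _ p _ κ hκ v hv
  obtain ⟨ε, hε⟩ :=
    LocalSplitPrime.exists_uniform_localization_shiftH1_modPTwist_invTwist_of_isCyclotomic W p κ hκ {v}
      (fun v' hv' => by rwa [Finset.mem_singleton.mp hv'])
  exact ⟨ε, fun J c => hε le_rfl v (Finset.mem_singleton_self v) J c⟩

/-! ## (L-ur), every prime -/

-- adapted from `SelmerDual.localUnramified` (…X9SelmerDualLocalUnramified, k6-lur-a p462896): dead prefix binders
-- (`γ`, `p ≠ 2`, irreducible, `¬`surjective, cyclotomic, top generator) struck; proof unchanged after `intro`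
/-- **(L-ur), every prime `p`**: for a finite place `v ∤ p` of `ℚ` at which `E[p]` is unramified AND `E` has
good reduction, a fine class `y ∈ H¹(ℚ_∞, E[p])` and the data `y_n, Y, Ψ, k` tied to `y` by the assembly's
three relations (`res y_n = res y`, `Sh(Y) = y_n`, `T^{p^n−J−1}· Ψ = T^k Y`), the localisation of `Ψ` at `v`
lies in `H¹_ur(ℚ_v, 𝒯_{J+1}(E, κ⁻¹))`.  Steps: fine ⟹ `res_{I_𝔓} y = 0` (Castella (B′), AEC X.4.4 / VIII.1.4;
`I_𝔓 ≤ Gal(ℚ̄/ℚ_∞)`, Washington 13.2) ⟹ a cocycle of `y_n` vanishes on every `Γ_n ∩ I_𝔓` ⟹ so does one of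
`Y = coresShapiro n y_n` (x9 `CoresUnramified`) ⟹ so does every cocycle of `Ψ` (coboundaries die on `I_𝔓`,
`T`-embedding injective) ⟹ `loc_v Ψ ∈ H¹_ur` (k6-g3 `KolyvaginTwist`).
[cite: SilvermanAEC2009, Cor. X.4.4 (proof of Thm. X.4.2(b))] [cite: Washington1997, Prop. 13.2]
[cite: SerreGaloisCohomology1997, I §2.5 Prop. 10] [cite: MilneADT2006, Ch. I §2 (unramified cohomology)] -/
theorem localUnramified' :
    ∀ (W : WeierstrassCurve ℚ) [W.IsElliptic] [W.IsGloballyMinimal] (p : ℕ) [Fact p.Prime]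
      (κ : ZpExtension ℚ p) (v : HeightOneSpectrum (𝓞 ℚ)), ((p : ℕ) : 𝓞 ℚ) ∉ v.asIdeal →
        GaloisRep.IsUnramifiedAt v (W.torsionGaloisModule (p : ℤ)) → W.HasGoodReductionAt v →
        ∀ (J n : ℕ) (hJn : J + 1 ≤ p ^ n)
          (y : Literature.NumberTheory.EllipticCurves.subgroupH1 κ.kerSubgroup
            (WeierstrassCurve.geomTorsion W (p : ℤ))),
          W.torsionToPrimaryH1Sub p κ.kerSubgroup y ∈ W.fineSelmerInfty κ →
          ∀ (yn : Literature.NumberTheory.EllipticCurves.subgroupH1 (κ.invTwist.layerSubgroup n)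
              (WeierstrassCurve.geomTorsion W (p : ℤ)))
            (Y : galoisCohomology (W.modPTwist p κ.invTwist (p ^ n)) 1)
            (Ψ : galoisCohomology (W.modPTwist p κ.invTwist (J + 1)) 1) (k : ℕ),
            Literature.NumberTheory.EllipticCurves.resOfLe (WeierstrassCurve.geomTorsion W (p : ℤ))
                (κ.invTwist.kerSubgroup_le_layerSubgroup n) yn =
              Literature.NumberTheory.EllipticCurves.resOfLe (WeierstrassCurve.geomTorsion W (p : ℤ))
                (κ.kerSubgroup_unitTwist (-1)).le y →
            κ.invTwist.twistModPH1Equiv (W.torsionGaloisModule (p : ℤ))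
              (fun P : WeierstrassCurve.geomTorsion W (p : ℤ) => AddSubgroup.torsionBy.nsmul P) n Y = yn →
            galoisCohomology.map (κ.invTwist.twistModPShiftEmbed (W.torsionGaloisModule (p : ℤ))
              (fun P : WeierstrassCurve.geomTorsion W (p : ℤ) => AddSubgroup.torsionBy.nsmul P) (p ^ n) hJn)
                1 Ψ =
              (κ.invTwist.shiftH1 (W.torsionGaloisModule (p : ℤ))
                (fun P : WeierstrassCurve.geomTorsion W (p : ℤ) => AddSubgroup.torsionBy.nsmul P)
                (p ^ n))^[k] Y →
            galoisCohomology.localization (W.modPTwist p κ.invTwist (J + 1)) (Sum.inr v) 1 Ψ ∈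
              DiscreteGaloisModule.unramifiedSubgroup
                (GaloisRep.toLocal v (W.modPTwist p κ.invTwist (J + 1))) 1 := by
  intro W _ _ p _ κ v hvp hvur hgood J n hJn y hy yn Y Ψ k hyn hSh hΨemb
  letI : Fintype (absoluteGaloisGroup ℚ ⧸ κ.invTwist.layerSubgroup n) := κ.invTwist.fintypeQuotientLayer n
  -- notation
  set ρ : DiscreteGaloisModule ℚ (geomTorsion W (p : ℤ)) := W.torsionGaloisModule (p : ℤ) with hρ
  have hM : ∀ P : geomTorsion W (p : ℤ), p • P = 0 := fun P => AddSubgroup.torsionBy.nsmul P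
  -- the inertia groups above `v` lie in `Gal(ℚ̄/ℚ_∞) = ker κ = ker κ⁻¹ ≤ Γ_n(κ⁻¹)`
  have hIker : ∀ 𝔓 ∈ v.primesAbove, 𝔓.inertia (absoluteGaloisGroup ℚ) ≤ κ.kerSubgroup :=
    fun 𝔓 h𝔓 => ZpExtension.inertia_le_kerSubgroup_holds ℚ p κ hvp h𝔓
  have hIlayer : ∀ 𝔓 ∈ v.primesAbove,
      𝔓.inertia (absoluteGaloisGroup ℚ) ≤ κ.invTwist.layerSubgroup n := fun 𝔓 h𝔓 =>
    ((hIker 𝔓 h𝔓).trans (κ.kerSubgroup_unitTwist (-1)).ge).trans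
      (κ.invTwist.kerSubgroup_le_layerSubgroup n)
  -- `E[p]` unramified at `v`: the inertia groups above `v` act trivially
  have hfix : ∀ 𝔓 ∈ v.primesAbove, ∀ τ ∈ 𝔓.inertia (absoluteGaloisGroup ℚ),
      ∀ P : geomTorsion W (p : ℤ), τ • P = P := fun 𝔓 h𝔓 τ hτ P => by
    rw [← W.torsionGaloisModule_apply_apply (p : ℤ) τ P, hvur 𝔓 h𝔓 τ hτ]
    rfl
  -- STEP 1: `y` fine ⟹ `res_{I_𝔓} y = 0` (Castella (B′); good reduction at `v ∤ p`)
  have hfine : ∀ σ : absoluteGaloisGroup ℚ,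
      W.conjH1 p κ.kerSubgroup σ (W.torsionToPrimaryH1Sub p κ.kerSubgroup y) ∈
        GreenbergSelmer.awayKer κ.kerSubgroup (geomPrimaryTorsion W p) v :=
    fun σ => ((GreenbergSelmer.mem_strictSelmerGroupOver_iff _).1 hy).1 v hvp σ
  have hbad : v ∉ W.badPlaces (𝓞 ℚ) := fun h => (W.mem_badPlaces_iff v).1 h hgood
  have hres_y : ∀ 𝔓 (h𝔓 : 𝔓 ∈ v.primesAbove),
      Literature.NumberTheory.EllipticCurves.resOfLe (geomTorsion W (p : ℤ)) (hIker 𝔓 h𝔓) y = 0 :=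
    fun 𝔓 h𝔓 => Castella2018.AcSelmer.resOfLe_torsion_eq_zero_of_forall_conjH1_mem_awayKer
      (H := κ.kerSubgroup) hfine hbad hvp h𝔓 (hIker 𝔓 h𝔓)
  -- … transported to `y_n` (`res y_n = res y`)
  have hres_yn : ∀ 𝔓 (h𝔓 : 𝔓 ∈ v.primesAbove),
      Literature.NumberTheory.EllipticCurves.resOfLe (geomTorsion W (p : ℤ)) (hIlayer 𝔓 h𝔓) yn = 0 := by
    intro 𝔓 h𝔓
    have hI' : 𝔓.inertia (absoluteGaloisGroup ℚ) ≤ κ.invTwist.kerSubgroup :=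
      (hIker 𝔓 h𝔓).trans (κ.kerSubgroup_unitTwist (-1)).ge
    have e1 : Literature.NumberTheory.EllipticCurves.resOfLe (geomTorsion W (p : ℤ)) (hIlayer 𝔓 h𝔓) yn =
        Literature.NumberTheory.EllipticCurves.resOfLe (geomTorsion W (p : ℤ)) hI'
          (Literature.NumberTheory.EllipticCurves.resOfLe (geomTorsion W (p : ℤ))
            (κ.invTwist.kerSubgroup_le_layerSubgroup n) yn) := by
      rw [← AddMonoidHom.comp_apply, resOfLe_comp_holds (M := geomTorsion W (p : ℤ)) hI'
        (κ.invTwist.kerSubgroup_le_layerSubgroup n)]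
    rw [e1, hyn, ← AddMonoidHom.comp_apply, resOfLe_comp_holds (M := geomTorsion W (p : ℤ)) hI'
      (κ.kerSubgroup_unitTwist (-1)).le]
    exact hres_y 𝔓 h𝔓
  -- … and made pointwise on a cocycle `f` of `y_n` (`I_𝔓` acts trivially on `E[p]`)
  obtain ⟨f, hf⟩ :=
    oneCocycleClass_surjective (subgroupRep ρ.toTopRep (κ.invTwist.layerSubgroup n)) yn
  have hf0 : ∀ 𝔓 ∈ v.primesAbove, ∀ g : κ.invTwist.layerSubgroup n,
      (g : absoluteGaloisGroup ℚ) ∈ 𝔓.inertia (absoluteGaloisGroup ℚ) → f.1 g = 0 := by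
    intro 𝔓 h𝔓 g hg
    have h0 := hres_yn 𝔓 h𝔓
    rw [← hf] at h0
    obtain ⟨a, ha⟩ := (resOfLe_oneCocycleClass_eq_zero_iff (M := geomTorsion W (p : ℤ))
      (κ.invTwist.layerSubgroup n) (hIlayer 𝔓 h𝔓) f).1 h0
    have h1 := ha ⟨g, hg⟩
    rw [hfix 𝔓 h𝔓 g hg a, sub_self] at h1
    exact h1
  -- STEP 2: `Y = coresShapiro n y_n` has a cocycle `F` vanishing on every `I_𝔓`, `𝔓 ∣ v` (x9)
  obtain ⟨F, hF, hF0⟩ := CoresUnramified.exists_cocycle_coresShapiro_apply_eq_zero_of_forall_primesAbove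
    κ.invTwist ρ hM n hvp f hf0
  rw [hf] at hF
  have hY : Y = κ.invTwist.coresShapiro ρ hM n yn := by
    rw [← hSh, κ.invTwist.coresShapiro_twistModPH1Equiv]
  have hFY : oneCocycleClass _ F = Y := hF.trans hY.symm
  subst hFY
  -- STEP 3: every cocycle `ψ` of `Ψ` vanishes on every `I_𝔓`, `𝔓 ∣ v`
  obtain ⟨ψ, rfl⟩ := oneCocycleClass_surjective (W.modPTwist p κ.invTwist (J + 1)).toTopRep Ψ
  have hact : ∀ 𝔓 ∈ v.primesAbove, ∀ τ ∈ 𝔓.inertia (absoluteGaloisGroup ℚ),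
      ∀ x : Fin (p ^ n) → geomTorsion W (p : ℤ), κ.invTwist.twistModP ρ hM (p ^ n) τ x = x := by
    intro 𝔓 h𝔓 τ hτ x
    rw [κ.invTwist.twistModP_apply_of_mem_layerSubgroup ρ hM (p ^ n) (m := n)
      (Nat.lt_pow_self (Fact.out : p.Prime).one_lt).le le_rfl (hIlayer 𝔓 h𝔓 hτ)]
    funext i
    rw [hρ, W.torsionGaloisModule_apply_apply]
    exact hfix 𝔓 h𝔓 τ hτ (x i)
  have hψ0 : ∀ 𝔓 ∈ v.primesAbove, ∀ τ ∈ 𝔓.inertia (absoluteGaloisGroup ℚ), ψ.1 τ = 0 :=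
    fun 𝔓 h𝔓 => apply_eq_zero_of_map_shiftEmbed_eq_shiftH1_iterate κ.invTwist ρ hM hJn k ψ F hΨemb
      (hact 𝔓 h𝔓) (hF0 𝔓 h𝔓)
  -- STEP 4: a global cocycle vanishing on `I_{𝔓₀}` has unramified localisation (k6-g3)
  exact KolyvaginTwist.localization_mem_unramifiedSubgroup_of_forall_inertia_apply_eq_zero
    (W.modPTwist p κ.invTwist (J + 1)) v ψ (hψ0 _ (adicCompletionPrime_mem_primesAbove ℚ v))

end Summit.BirchSwinnertonDyer.BirchSwinnertonDyer.Rank1Residual.SelmerDual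

end
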